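import Mathlib
import Summits.Ventures.PercRepro2.Graph

/-!
# Merging a vertex set by opening edges inside it (blind cell PercRepro2, p4 g17; S3 (G4-u) item (ad))

The one combinatorial fact behind every coin / pocket mass table: if `ω ≤ ω'` and every edge open
in `ω'` but closed in `ω` has both ends in a set `S` that is `ω'`-connected, then

  `Conn ω' x y ↔ Conn ω x y ∨ (x ~_ω S ∧ y ~_ω S)`   (`conn_merge_iff`),

where `x ~_ω S` means `x` is `ω`-connected to some vertex of `S`.  Opening coins at a vertex `b`
whose edges are exactly the coins (`b` isolated once they are closed) is the special case
`S = {b} ∪ {marks of the open coins}`: `conn_star_iff` / `conn_star_b_iff` give the connectivity of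
every coin world in terms of the connectivity of the configuration with all coins closed.
-/

namespace Summit.Ventures.PercRepro2

namespace RootLeafU

namespace Merge

variable {V : Type*} {E : Type*}

/-- **The merge lemma.** -/
theorem conn_merge_iff {ends : E → Sym2 V} {ω ω' : Config E} (hle : ω ≤ ω') {S : Set V}
    (hnew : ∀ e, ω' e = true → ω e = false → ∃ x ∈ S, ∃ y ∈ S, ends e = s(x, y))
    (hS : ∀ x ∈ S, ∀ y ∈ S, Conn ends ω' x y) (x y : V) :
    Conn ends ω' x y ↔
      Conn ends ω x y ∨ ((∃ s ∈ S, Conn ends ω x s) ∧ ∃ s' ∈ S, Conn ends ω y s') := by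
  constructor
  · intro h
    have hT : ∀ v ∈ {w | Conn ends ω x w ∨ ((∃ s ∈ S, Conn ends ω x s) ∧ ∃ s' ∈ S, Conn ends ω w s')},
        ∀ w, (openGraph ends ω').Adj v w →
          w ∈ {w | Conn ends ω x w ∨ ((∃ s ∈ S, Conn ends ω x s) ∧ ∃ s' ∈ S, Conn ends ω w s')} := by
      intro v hv w hvw
      rw [openGraph_adj] at hvw
      obtain ⟨_, e, he, hends⟩ := hvw
      by_cases hωe : ω e = true
      · have hvw' : Conn ends ω v w := conn_of_openAdj ⟨e, hωe, hends⟩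
        rcases hv with hv | ⟨hxs, s', hs', hvs'⟩
        · exact Or.inl (conn_trans hv hvw')
        · exact Or.inr ⟨hxs, s', hs', conn_trans (conn_symm hvw') hvs'⟩
      · have hωe' : ω e = false := by simpa using hωe
        obtain ⟨x', hx', y', hy', hxy'⟩ := hnew e he hωe'
        rw [hends] at hxy'
        have hmem : v ∈ S ∧ w ∈ S := by
          rcases Sym2.eq_iff.1 hxy' with ⟨h1, h2⟩ | ⟨h1, h2⟩
          · subst h1; subst h2; exact ⟨hx', hy'⟩
          · subst h1; subst h2; exact ⟨hy', hx'⟩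
        rcases hv with hv | ⟨hxs, _⟩
        · exact Or.inr ⟨⟨v, hmem.1, hv⟩, w, hmem.2, conn_refl _ _ _⟩
        · exact Or.inr ⟨hxs, w, hmem.2, conn_refl _ _ _⟩
    exact mem_of_conn_of_closed hT (Or.inl (conn_refl _ _ _)) h
  · rintro (h | ⟨⟨s, hs, hxs⟩, s', hs', hys'⟩)
    · exact conn_mono hle h
    · exact conn_trans (conn_mono hle hxs)
        (conn_trans (hS s hs s' hs') (conn_symm (conn_mono hle hys')))

/-- A vertex all of whose edges are closed is isolated. -/
theorem eq_of_conn_of_closed_edges {ends : E → Sym2 V} {ω : Config E} {b : V}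
    (hb : ∀ e, (∃ y, ends e = s(b, y)) → ω e = false) {x : V} (h : Conn ends ω x b) : x = b := by
  have hT : ∀ v ∈ ({b} : Set V), ∀ w, (openGraph ends ω).Adj v w → w ∈ ({b} : Set V) := by
    intro v hv w hvw
    rw [Set.mem_singleton_iff] at hv
    subst hv
    rw [openGraph_adj] at hvw
    obtain ⟨_, e, he, hends⟩ := hvw
    have := hb e ⟨w, hends⟩
    rw [he] at this
    exact absurd this (by decide)
  exact (mem_of_conn_of_closed hT (Set.mem_singleton b) (conn_symm h))


/-! ## The coin worlds of a star at `b` -/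

section Star

variable [DecidableEq E] {ends : E → Sym2 V} {b a₂ u c : V} {f₁ f₂ f₃ : E}

/-- With all coins closed, `b` is isolated. -/
theorem eq_b_of_conn_closed (hstar : ∀ e, (∃ y, ends e = s(b, y)) → e = f₁ ∨ e = f₂ ∨ e = f₃)
    (ω : Config E) {v : V}
    (h : Conn ends (Function.update (Function.update (Function.update ω f₃ false) f₂ false) f₁ false)
      v b) : v = b := by
  refine eq_of_conn_of_closed_edges (fun e he => ?_) h
  rcases hstar e he with h1 | h2 | h3
  · rw [h1]; simp
  · rw [h2]
    by_cases h21 : f₂ = f₁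
    · rw [h21]; simp
    · simp [Function.update_of_ne h21]
  · rw [h3]
    by_cases h31 : f₃ = f₁
    · rw [h31]; simp
    · rw [Function.update_of_ne h31]
      by_cases h32 : f₃ = f₂
      · rw [h32]; simp
      · simp [Function.update_of_ne h32]

/-- **The coin worlds of the star**: with `ω₀` the configuration with the three coins closed and
`ω_{xyz}` the one with the coins set to `(x, y, z)`, for marks `v, w ≠ b`
`Conn ω_{xyz} v w ↔ Conn ω₀ v w ∨ (v ~₀ S ∧ w ~₀ S)` where `v ~₀ S` = `v` is `ω₀`-connected to a
mark whose coin is open. -/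
theorem conn_star_iff (hf₁ : ends f₁ = s(b, a₂)) (hf₂ : ends f₂ = s(b, u)) (hf₃ : ends f₃ = s(b, c))
    (hstar : ∀ e, (∃ y, ends e = s(b, y)) → e = f₁ ∨ e = f₂ ∨ e = f₃)
    (h12 : f₁ ≠ f₂) (h13 : f₁ ≠ f₃) (h23 : f₂ ≠ f₃) (ω : Config E) (x y z : Bool) {v w : V}
    (hv : v ≠ b) (hw : w ≠ b) :
    Conn ends (Function.update (Function.update (Function.update ω f₃ z) f₂ y) f₁ x) v w ↔
      Conn ends (Function.update (Function.update (Function.update ω f₃ false) f₂ false) f₁ false)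
          v w ∨
        (((x = true ∧ Conn ends (Function.update (Function.update (Function.update ω f₃ false) f₂ false) f₁ false) v a₂) ∨
          (y = true ∧ Conn ends (Function.update (Function.update (Function.update ω f₃ false) f₂ false) f₁ false) v u) ∨
          (z = true ∧ Conn ends (Function.update (Function.update (Function.update ω f₃ false) f₂ false) f₁ false) v c)) ∧
         ((x = true ∧ Conn ends (Function.update (Function.update (Function.update ω f₃ false) f₂ false) f₁ false) w a₂) ∨
          (y = true ∧ Conn ends (Function.update (Function.update (Function.update ω f₃ false) f₂ false) f₁ false) w u) ∨
          (z = true ∧ Conn ends (Function.update (Function.update (Function.update ω f₃ false) f₂ false) f₁ false) w c))) := by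
  set ω₀ := Function.update (Function.update (Function.update ω f₃ false) f₂ false) f₁ false with hω₀
  set ω' := Function.update (Function.update (Function.update ω f₃ z) f₂ y) f₁ x with hω'
  -- the merged set
  set S : Set V := {p | p = b ∨ (x = true ∧ p = a₂) ∨ (y = true ∧ p = u) ∨ (z = true ∧ p = c)} with hS
  have hω'₁ : ω' f₁ = x := by simp [hω']
  have hω'₂ : ω' f₂ = y := by simp [hω', Function.update_of_ne h12.symm]
  have hω'₃ : ω' f₃ = z := by simp [hω', Function.update_of_ne h13.symm, Function.update_of_ne h23.symm]
  have hω₀₁ : ω₀ f₁ = false := by simp [hω₀]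
  have hω₀₂ : ω₀ f₂ = false := by simp [hω₀, Function.update_of_ne h12.symm]
  have hω₀₃ : ω₀ f₃ = false := by simp [hω₀, Function.update_of_ne h13.symm, Function.update_of_ne h23.symm]
  have hother : ∀ e, e ≠ f₁ → e ≠ f₂ → e ≠ f₃ → ω₀ e = ω e ∧ ω' e = ω e := by
    intro e h1 h2 h3
    simp [hω₀, hω', Function.update_of_ne h1, Function.update_of_ne h2, Function.update_of_ne h3]
  have hle : ω₀ ≤ ω' := by
    intro e
    by_cases h1 : e = f₁
    · subst h1; rw [hω₀₁]; exact Bool.false_le _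
    by_cases h2 : e = f₂
    · subst h2; rw [hω₀₂]; exact Bool.false_le _
    by_cases h3 : e = f₃
    · subst h3; rw [hω₀₃]; exact Bool.false_le _
    rw [(hother e h1 h2 h3).1, (hother e h1 h2 h3).2]
  have hnew : ∀ e, ω' e = true → ω₀ e = false → ∃ p ∈ S, ∃ q ∈ S, ends e = s(p, q) := by
    intro e he he0
    by_cases h1 : e = f₁
    · subst h1
      rw [hω'₁] at he
      exact ⟨b, Or.inl rfl, a₂, Or.inr (Or.inl ⟨he, rfl⟩), hf₁⟩
    by_cases h2 : e = f₂
    · subst h2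
      rw [hω'₂] at he
      exact ⟨b, Or.inl rfl, u, Or.inr (Or.inr (Or.inl ⟨he, rfl⟩)), hf₂⟩
    by_cases h3 : e = f₃
    · subst h3
      rw [hω'₃] at he
      exact ⟨b, Or.inl rfl, c, Or.inr (Or.inr (Or.inr ⟨he, rfl⟩)), hf₃⟩
    rw [(hother e h1 h2 h3).2] at he
    rw [(hother e h1 h2 h3).1] at he0
    rw [he] at he0
    exact absurd he0 (by decide)
  have hSb : ∀ p ∈ S, Conn ends ω' b p := by
    intro p hp
    rcases hp with rfl | ⟨hx, rfl⟩ | ⟨hy, rfl⟩ | ⟨hz, rfl⟩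
    · exact conn_refl _ _ _
    · exact conn_of_openAdj ⟨f₁, by rw [hω'₁, hx], hf₁⟩
    · exact conn_of_openAdj ⟨f₂, by rw [hω'₂, hy], hf₂⟩
    · exact conn_of_openAdj ⟨f₃, by rw [hω'₃, hz], hf₃⟩
  have hSS : ∀ p ∈ S, ∀ q ∈ S, Conn ends ω' p q := fun p hp q hq =>
    conn_trans (conn_symm (hSb p hp)) (hSb q hq)
  have hiso : ∀ p, p ≠ b → ¬ Conn ends ω₀ p b := fun p hp h =>
    hp (eq_b_of_conn_closed hstar ω h)
  have hmem : ∀ p, p ≠ b → ((∃ s ∈ S, Conn ends ω₀ p s) ↔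
      ((x = true ∧ Conn ends ω₀ p a₂) ∨ (y = true ∧ Conn ends ω₀ p u) ∨
        (z = true ∧ Conn ends ω₀ p c))) := by
    intro p hp
    constructor
    · rintro ⟨s, hs, hps⟩
      rcases hs with rfl | ⟨hx, rfl⟩ | ⟨hy, rfl⟩ | ⟨hz, rfl⟩
      · exact absurd hps (hiso p hp)
      · exact Or.inl ⟨hx, hps⟩
      · exact Or.inr (Or.inl ⟨hy, hps⟩)
      · exact Or.inr (Or.inr ⟨hz, hps⟩)
    · rintro (⟨hx, h⟩ | ⟨hy, h⟩ | ⟨hz, h⟩)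
      · exact ⟨a₂, Or.inr (Or.inl ⟨hx, rfl⟩), h⟩
      · exact ⟨u, Or.inr (Or.inr (Or.inl ⟨hy, rfl⟩)), h⟩
      · exact ⟨c, Or.inr (Or.inr (Or.inr ⟨hz, rfl⟩)), h⟩
  rw [conn_merge_iff hle hnew hSS v w, hmem v hv, hmem w hw]

/-- The coin worlds of the star, `b` itself: `Conn ω_{xyz} v b ↔ v ~₀ S` for `v ≠ b`. -/
theorem conn_star_b_iff (hf₁ : ends f₁ = s(b, a₂)) (hf₂ : ends f₂ = s(b, u)) (hf₃ : ends f₃ = s(b, c))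
    (hstar : ∀ e, (∃ y, ends e = s(b, y)) → e = f₁ ∨ e = f₂ ∨ e = f₃)
    (h12 : f₁ ≠ f₂) (h13 : f₁ ≠ f₃) (h23 : f₂ ≠ f₃) (ω : Config E) (x y z : Bool) {v : V}
    (hv : v ≠ b) :
    Conn ends (Function.update (Function.update (Function.update ω f₃ z) f₂ y) f₁ x) v b ↔
      ((x = true ∧ Conn ends (Function.update (Function.update (Function.update ω f₃ false) f₂ false) f₁ false) v a₂) ∨
        (y = true ∧ Conn ends (Function.update (Function.update (Function.update ω f₃ false) f₂ false) f₁ false) v u) ∨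
        (z = true ∧ Conn ends (Function.update (Function.update (Function.update ω f₃ false) f₂ false) f₁ false) v c)) := by
  set ω₀ := Function.update (Function.update (Function.update ω f₃ false) f₂ false) f₁ false with hω₀
  set ω' := Function.update (Function.update (Function.update ω f₃ z) f₂ y) f₁ x with hω'
  set S : Set V := {p | p = b ∨ (x = true ∧ p = a₂) ∨ (y = true ∧ p = u) ∨ (z = true ∧ p = c)} with hS
  have hω'₁ : ω' f₁ = x := by simp [hω']
  have hω'₂ : ω' f₂ = y := by simp [hω', Function.update_of_ne h12.symm]
  have hω'₃ : ω' f₃ = z := by simp [hω', Function.update_of_ne h13.symm, Function.update_of_ne h23.symm]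
  have hω₀₁ : ω₀ f₁ = false := by simp [hω₀]
  have hω₀₂ : ω₀ f₂ = false := by simp [hω₀, Function.update_of_ne h12.symm]
  have hω₀₃ : ω₀ f₃ = false := by simp [hω₀, Function.update_of_ne h13.symm, Function.update_of_ne h23.symm]
  have hother : ∀ e, e ≠ f₁ → e ≠ f₂ → e ≠ f₃ → ω₀ e = ω e ∧ ω' e = ω e := by
    intro e h1 h2 h3
    simp [hω₀, hω', Function.update_of_ne h1, Function.update_of_ne h2, Function.update_of_ne h3]
  have hle : ω₀ ≤ ω' := by
    intro e
    by_cases h1 : e = f₁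
    · subst h1; rw [hω₀₁]; exact Bool.false_le _
    by_cases h2 : e = f₂
    · subst h2; rw [hω₀₂]; exact Bool.false_le _
    by_cases h3 : e = f₃
    · subst h3; rw [hω₀₃]; exact Bool.false_le _
    rw [(hother e h1 h2 h3).1, (hother e h1 h2 h3).2]
  have hnew : ∀ e, ω' e = true → ω₀ e = false → ∃ p ∈ S, ∃ q ∈ S, ends e = s(p, q) := by
    intro e he he0
    by_cases h1 : e = f₁
    · subst h1
      rw [hω'₁] at he
      exact ⟨b, Or.inl rfl, a₂, Or.inr (Or.inl ⟨he, rfl⟩), hf₁⟩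
    by_cases h2 : e = f₂
    · subst h2
      rw [hω'₂] at he
      exact ⟨b, Or.inl rfl, u, Or.inr (Or.inr (Or.inl ⟨he, rfl⟩)), hf₂⟩
    by_cases h3 : e = f₃
    · subst h3
      rw [hω'₃] at he
      exact ⟨b, Or.inl rfl, c, Or.inr (Or.inr (Or.inr ⟨he, rfl⟩)), hf₃⟩
    rw [(hother e h1 h2 h3).2] at he
    rw [(hother e h1 h2 h3).1] at he0
    rw [he] at he0
    exact absurd he0 (by decide)
  have hSb : ∀ p ∈ S, Conn ends ω' b p := by
    intro p hp
    rcases hp with rfl | ⟨hx, rfl⟩ | ⟨hy, rfl⟩ | ⟨hz, rfl⟩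
    · exact conn_refl _ _ _
    · exact conn_of_openAdj ⟨f₁, by rw [hω'₁, hx], hf₁⟩
    · exact conn_of_openAdj ⟨f₂, by rw [hω'₂, hy], hf₂⟩
    · exact conn_of_openAdj ⟨f₃, by rw [hω'₃, hz], hf₃⟩
  have hSS : ∀ p ∈ S, ∀ q ∈ S, Conn ends ω' p q := fun p hp q hq =>
    conn_trans (conn_symm (hSb p hp)) (hSb q hq)
  have hiso : ¬ Conn ends ω₀ v b := fun h => hv (eq_b_of_conn_closed hstar ω h)
  rw [conn_merge_iff hle hnew hSS v b]
  constructor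
  · rintro (h | ⟨⟨s, hs, hvs⟩, _⟩)
    · exact absurd h hiso
    · rcases hs with rfl | ⟨hx, rfl⟩ | ⟨hy, rfl⟩ | ⟨hz, rfl⟩
      · exact absurd hvs hiso
      · exact Or.inl ⟨hx, hvs⟩
      · exact Or.inr (Or.inl ⟨hy, hvs⟩)
      · exact Or.inr (Or.inr ⟨hz, hvs⟩)
  · rintro (⟨hx, h⟩ | ⟨hy, h⟩ | ⟨hz, h⟩)
    · exact Or.inr ⟨⟨a₂, Or.inr (Or.inl ⟨hx, rfl⟩), h⟩, b, Or.inl rfl, conn_refl _ _ _⟩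
    · exact Or.inr ⟨⟨u, Or.inr (Or.inr (Or.inl ⟨hy, rfl⟩)), h⟩, b, Or.inl rfl, conn_refl _ _ _⟩
    · exact Or.inr ⟨⟨c, Or.inr (Or.inr (Or.inr ⟨hz, rfl⟩)), h⟩, b, Or.inl rfl, conn_refl _ _ _⟩

/-- A single open coin merges `b` into one mark only, which changes no connection between
vertices other than `b`: world `100`. -/
theorem conn_star_100_iff (hf₁ : ends f₁ = s(b, a₂)) (hf₂ : ends f₂ = s(b, u)) (hf₃ : ends f₃ = s(b, c))
    (hstar : ∀ e, (∃ y, ends e = s(b, y)) → e = f₁ ∨ e = f₂ ∨ e = f₃)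
    (h12 : f₁ ≠ f₂) (h13 : f₁ ≠ f₃) (h23 : f₂ ≠ f₃) (ω : Config E) {v w : V}
    (hv : v ≠ b) (hw : w ≠ b) :
    Conn ends (Function.update (Function.update (Function.update ω f₃ false) f₂ false) f₁ true) v w ↔
      Conn ends (Function.update (Function.update (Function.update ω f₃ false) f₂ false) f₁ false) v w := by
  rw [conn_star_iff hf₁ hf₂ hf₃ hstar h12 h13 h23 ω true false false hv hw]
  simp only [true_and, Bool.false_eq_true, false_and, or_false]
  constructor
  · rintro (h | ⟨h1, h2⟩)
    · exact h
    · exact conn_trans h1 (conn_symm h2)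
  · intro h; exact Or.inl h

/-- World `010`. -/
theorem conn_star_010_iff (hf₁ : ends f₁ = s(b, a₂)) (hf₂ : ends f₂ = s(b, u)) (hf₃ : ends f₃ = s(b, c))
    (hstar : ∀ e, (∃ y, ends e = s(b, y)) → e = f₁ ∨ e = f₂ ∨ e = f₃)
    (h12 : f₁ ≠ f₂) (h13 : f₁ ≠ f₃) (h23 : f₂ ≠ f₃) (ω : Config E) {v w : V}
    (hv : v ≠ b) (hw : w ≠ b) :
    Conn ends (Function.update (Function.update (Function.update ω f₃ false) f₂ true) f₁ false) v w ↔
      Conn ends (Function.update (Function.update (Function.update ω f₃ false) f₂ false) f₁ false) v w := by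
  rw [conn_star_iff hf₁ hf₂ hf₃ hstar h12 h13 h23 ω false true false hv hw]
  simp only [true_and, Bool.false_eq_true, false_and, or_false, false_or]
  constructor
  · rintro (h | ⟨h1, h2⟩)
    · exact h
    · exact conn_trans h1 (conn_symm h2)
  · intro h; exact Or.inl h

/-- World `001`. -/
theorem conn_star_001_iff (hf₁ : ends f₁ = s(b, a₂)) (hf₂ : ends f₂ = s(b, u)) (hf₃ : ends f₃ = s(b, c))
    (hstar : ∀ e, (∃ y, ends e = s(b, y)) → e = f₁ ∨ e = f₂ ∨ e = f₃)
    (h12 : f₁ ≠ f₂) (h13 : f₁ ≠ f₃) (h23 : f₂ ≠ f₃) (ω : Config E) {v w : V}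
    (hv : v ≠ b) (hw : w ≠ b) :
    Conn ends (Function.update (Function.update (Function.update ω f₃ true) f₂ false) f₁ false) v w ↔
      Conn ends (Function.update (Function.update (Function.update ω f₃ false) f₂ false) f₁ false) v w := by
  rw [conn_star_iff hf₁ hf₂ hf₃ hstar h12 h13 h23 ω false false true hv hw]
  simp only [true_and, Bool.false_eq_true, false_and, false_or]
  constructor
  · rintro (h | ⟨h1, h2⟩)
    · exact h
    · exact conn_trans h1 (conn_symm h2)
  · intro h; exact Or.inl h

end Star

end Merge

end RootLeafU

end Summit.Ventures.PercRepro2
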